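import Summits.ValiantsHypothesis.ValiantsHypothesis.Theorems.BarrierLeverAnchoredDoorHitsLowerPairsDefs

/-!
# Support item `AnchoredDoorHitsLowerPairs` (stmt-ValiantsHypothesis-22510), line `anchored-peeling`:
# the BLOCK-PAIRING LEMMA — module M2 of the UQ_s-step blueprint, over any integral domain

Helper file (`--supports stmt-ValiantsHypothesis-22510`; cell valiant-natproofs, rung V4, 𝒟-side door (c); registered line
`Cruxes/AnchoredDoorHitsLowerPairs/Lines/anchored_peeling.lean` v12; prover seat val-np-p1 gen 19). Definition-free; pure linear algebra. Closes NO item.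

This is module M2 of the kernel blueprint for `Stmt.stub_uqStep` / `Stmt.stub_uqFaceStep` (p613507, p614490; HOME/val-np-p1/g19/QSTEP-BLUEPRINT-valnp1-g19.md),
in the elementary direction that the proof actually needs and WITHOUT a fraction field. After the one-peel of the UQ_s-step the generalized layout matrix `S` has a
set of rows `p` (the shifted link rows) vanishing on a set of columns `q` (the columns avoiding the target): `S[p, q] = 0`. Write `A = S[pᶜ, q]`, `E = S[p, qᶜ]`,
`Σ̃ = S[pᶜ, qᶜ]`.

* `det_ne_zero_of_blockPairing` — if the `p`-rows of `S` are linearly independent and the pairing `(x, y) ↦ x ⬝ (S y) = x Σ̃ y` between the left kernel of `A`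
  (vectors `x` supported on `pᶜ` with `(x S)|_q = 0`) and the right kernel of `E` (vectors `y` supported on `qᶜ` with `(S y)|_p = 0`) is LEFT-NONDEGENERATE, then
  `det S ≠ 0`. Proof: a nonzero `w` with `w S = 0` (`Matrix.exists_vecMul_eq_zero_iff`) splits as `w = x + z` (`x` on `pᶜ`, `z` on `p`); `z S` vanishes on `q`
  (zero block), hence so does `x S = −z S`; if `x = 0` then `z S = 0` forces `z = 0`; otherwise the witness `y` gives `x ⬝ S y = (x S) ⬝ y = −(z S) ⬝ y = −z ⬝ (S y) = 0`,
  a contradiction.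
In the UQ_s-step this reduces «peeled minor ≠ 0» to «the m×m cross pairing between the core syzygy space F₀ and the link annihilator 𝒱 is nondegenerate», which the
private-monomial extraction (modules M3–M4) then certifies.

WHAT THIS IS NOT: no statement about the door itself; nothing on crux stmt-ValiantsHypothesis-14610 or on `VP` versus `VNP`.
-/

set_option linter.dupNamespace false

namespace Summit.ValiantsHypothesis.ValiantsHypothesis.Theorems.BarrierLever.AnchoredPeeling

open Matrix

section BlockPairing

variable {A : Type*} [CommRing A] [IsDomain A] {m : Type*} [Fintype m] [DecidableEq m]

omit [IsDomain A] [DecidableEq m] in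
/-- A sum whose every term has a vanishing factor is zero (bookkeeping for supports). -/
private theorem sum_mul_eq_zero_of_disjoint (f g : m → A) (h : ∀ i, f i = 0 ∨ g i = 0) : ∑ i, f i * g i = 0 := by
  refine Finset.sum_eq_zero (fun i _ => ?_)
  rcases h i with hi | hi <;> simp [hi]

/-- **Block-pairing lemma (module M2).** Let `S` be a square matrix over an integral domain whose `p`-rows vanish on the `q`-columns. If the `p`-rows are linearly
independent and every nonzero `x` supported on `pᶜ` with `(x ᵥ* S)|_q = 0` pairs non-trivially with some `y` supported on `qᶜ` with `(S *ᵥ y)|_p = 0`, then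
`det S ≠ 0`. -/
theorem det_ne_zero_of_blockPairing (S : Matrix m m A) (p q : m → Prop) [DecidablePred p] [DecidablePred q]
    (hzero : ∀ i j, p i → q j → S i j = 0)
    (hE : ∀ z : m → A, (∀ i, ¬ p i → z i = 0) → z ᵥ* S = 0 → z = 0)
    (hpair : ∀ x : m → A, (∀ i, p i → x i = 0) → (∀ j, q j → (x ᵥ* S) j = 0) → x ≠ 0 →
      ∃ y : m → A, (∀ j, q j → y j = 0) ∧ (∀ i, p i → (S *ᵥ y) i = 0) ∧ x ⬝ᵥ (S *ᵥ y) ≠ 0) :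
    S.det ≠ 0 := by
  intro hdet
  obtain ⟨w, hw0, hwS⟩ := Matrix.exists_vecMul_eq_zero_iff.mpr hdet
  -- split w = x + z along p
  set x : m → A := fun i => if p i then 0 else w i with hx
  set z : m → A := fun i => if p i then w i else 0 with hz
  have hxz : x + z = w := by
    funext i
    simp only [Pi.add_apply, hx, hz]
    split_ifs <;> simp
  have hxsupp : ∀ i, p i → x i = 0 := fun i hi => by simp [hx, hi]
  have hzsupp : ∀ i, ¬ p i → z i = 0 := fun i hi => by simp [hz, hi]
  -- z ᵥ* S vanishes on q (zero block)
  have hzS : ∀ j, q j → (z ᵥ* S) j = 0 := by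
    intro j hj
    change ∑ i, z i * S i j = 0
    refine sum_mul_eq_zero_of_disjoint z (fun i => S i j) (fun i => ?_)
    by_cases hi : p i
    · exact Or.inr (hzero i j hi hj)
    · exact Or.inl (hzsupp i hi)
  -- x ᵥ* S = -(z ᵥ* S)
  have hsum : x ᵥ* S + z ᵥ* S = 0 := by rw [← add_vecMul, hxz, hwS]
  have hxS_eq : x ᵥ* S = -(z ᵥ* S) := eq_neg_of_add_eq_zero_left hsum
  have hxS : ∀ j, q j → (x ᵥ* S) j = 0 := by
    intro j hj
    rw [hxS_eq, Pi.neg_apply, hzS j hj, neg_zero]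
  by_cases hx0 : x = 0
  · -- then z = w is a dependency among the p-rows
    have hzw : z = w := by rw [← hxz, hx0, zero_add]
    have hz0 : z = 0 := hE z hzsupp (by rw [hzw, hwS])
    exact hw0 (by rw [← hzw, hz0])
  · obtain ⟨y, hysupp, hSy, hne⟩ := hpair x hxsupp hxS hx0
    apply hne
    calc x ⬝ᵥ (S *ᵥ y) = (x ᵥ* S) ⬝ᵥ y := dotProduct_mulVec x S y
      _ = -((z ᵥ* S) ⬝ᵥ y) := by rw [hxS_eq, neg_dotProduct]
      _ = -(z ⬝ᵥ (S *ᵥ y)) := by rw [dotProduct_mulVec]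
      _ = 0 := by
        rw [neg_eq_zero]
        change ∑ i, z i * (S *ᵥ y) i = 0
        refine sum_mul_eq_zero_of_disjoint z (S *ᵥ y) (fun i => ?_)
        by_cases hi : p i
        · exact Or.inr (hSy i hi)
        · exact Or.inl (hzsupp i hi)

/-- The symmetric (right-nondegenerate) form: it suffices that every nonzero `y` in the right kernel of `E` pairs non-trivially with some `x` in the left kernel of
`A`, provided the `q`-COLUMNS are linearly independent. -/
theorem det_ne_zero_of_blockPairing' (S : Matrix m m A) (p q : m → Prop) [DecidablePred p] [DecidablePred q]
    (hzero : ∀ i j, p i → q j → S i j = 0)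
    (hA : ∀ z : m → A, (∀ j, ¬ q j → z j = 0) → S *ᵥ z = 0 → z = 0)
    (hpair : ∀ y : m → A, (∀ j, q j → y j = 0) → (∀ i, p i → (S *ᵥ y) i = 0) → y ≠ 0 →
      ∃ x : m → A, (∀ i, p i → x i = 0) ∧ (∀ j, q j → (x ᵥ* S) j = 0) ∧ x ⬝ᵥ (S *ᵥ y) ≠ 0) :
    S.det ≠ 0 := by
  -- apply the row version to the transpose, with the roles of p and q exchanged
  rw [← Matrix.det_transpose]
  refine det_ne_zero_of_blockPairing S.transpose q p (fun j i hj hi => ?_) (fun z hz hzS => hA z hz ?_) (fun y hy hyS hy0 => ?_)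
  · rw [Matrix.transpose_apply]; exact hzero i j hi hj
  · rwa [Matrix.vecMul_transpose] at hzS
  · obtain ⟨x, hxp, hxq, hne⟩ := hpair y hy (fun i hi => by have := hyS i hi; rwa [Matrix.vecMul_transpose] at this) hy0
    refine ⟨x, hxp, fun j hj => by rw [Matrix.mulVec_transpose]; exact hxq j hj, ?_⟩
    rw [Matrix.mulVec_transpose, dotProduct_comm, ← dotProduct_mulVec]
    exact hne

end BlockPairing

end Summit.ValiantsHypothesis.ValiantsHypothesis.Theorems.BarrierLever.AnchoredPeeling
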